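import Mathlib
import Literature.Analysis.FluidPDE.Tao2016AveragedNS.ViscousEternalSolutions
import Literature.Analysis.FluidPDE.Tao2016AveragedNS.BoundedEternalSolutions
import Summits.NavierStokesRegularity.NavierStokesRegularity.Theses.WakeRatchet
import HarnessLib

/-!
# `WakeRatchet.AdmissibleEternalBound` (stmt-NavierStokesRegularity-23197) — the SURVIVING form (A′):
# its logical position and the ready glue for the planner's restatement

MODEL lattice ODEs only (Tao 2016 §4, §6.4); nothing in this file is a statement about the
Navier–Stokes equations, and no route item is settled here.

CONTEXT.  The crux `AdmissibleEternalBound` (S: below a threshold every admissible viscous eternal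
solution of an E₂(R) table is `UniformBound`) is, as filed, decided only by open CONSTRUCTIONS:
`¬S` follows from `WakeRatchetSelfSimilar.GlobalSelfSimilarProfiles` (two-sided self-similar profiles,
re-centred after their focusing time) and from `WakeRatchetBounce.SymmetricDSSWaves`, while S holds on
every slice where a mechanism exists (inviscid forward cascades, the dyadic member, pure Katz–Pavlović
networks).  Four prover seats (ns-wake-p1 g5–g8) returned the verdict MISSTATED with the restatement

  (A′)  `∀ R ≥ 1, ∃ εs > 0, ∀ ε₀ ∈ (0, εs], ∀ α ∈ InTableClass R, ∀ ν̂ W,`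
        `IsEternalVisc ε₀ ν̂ α W → EternalSurvivingFwd 1 ε₀ W → UniformBound W`

— literally the clause the parent K2ᵛ (`EternalRigidityViscBddOne`, i.e. `EternalRigidityViscBdd R 1
= ∃ ν̂ W, IsEternalVisc ∧ UniformBound ∧ EternalSurvivingFwd 1`) consumes.  This file records, in the
kernel and with (A′) written out verbatim (no new definition is introduced), the three facts the
planner needs to restate the item:

* `survivingForm_of_admissibleEternalBound` — S ⇒ (A′): the restatement is a WEAKENING of the item.
* `eternalRigidityViscBddOne_of_survivingForm` — (A′) → `EternalRigidityViscOne` →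
  `EternalRigidityViscBddOne`: the split glue (item 23199, `EternalRigidityViscBddOneOfActionSplit`)
  goes through UNCHANGED with (A′) in place of S and the sibling crux 23198 untouched (take the minimum
  of the two thresholds; the extracted solution is surviving, hence bounded by (A′)).  The alternative
  repair `S_loc` (add «no interior blow-up» `∀ σ₀ ∃ K ∀ n ∀ σ ≤ σ₀, e^σ‖W n σ‖ ≤ K`) does NOT glue with
  23198 as typed — `EternalRigidityVisc R 1` does not deliver that hypothesis — so (A′) is the only
  entry of the restatement menu that keeps the rest of the split verbatim.
* `survivingForm_of_noSurvivingEternalVisc` — the viscous Liouville predicate K1ᵛ(1)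
  (`NoSurvivingEternalVisc R 1` for every `R ≥ 1`) makes (A′) VACUOUSLY true: (A′) has content exactly
  on the complement of K1ᵛ(1), i.e. it says «a surviving admissible eternal solution, should one exist,
  is type-I».  (Immunity of (A′) to the landed negative mechanisms is
  `WakeRatchetSelfSimilar.not_eternalSurvivingFwd_selfSimilar`: the re-centred self-similar witnesses
  never survive forward at any exponent `a < 5`.)

HONEST FRAMING: pure logic between tree predicates; (A′) is not filed as an item by this file (only a
planner files statements) and is not claimed to be provable — it is open in both directions, like S,
but it is no longer refuted by regular-at-the-centre witnesses.
-/

noncomputable section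

set_option linter.dupNamespace false

namespace Summit.NavierStokesRegularity.NavierStokesRegularity.Theorems

namespace WakeRatchetSurvivingForm

open Literature.Analysis.FluidPDE Literature.Analysis.FluidPDE.TaoCascade
open Summit.NavierStokesRegularity.NavierStokesRegularity.Theses.WakeRatchet

/-- **S ⇒ (A′).**  The crux `AdmissibleEternalBound` implies its surviving form (the extra hypothesis
`EternalSurvivingFwd 1 ε₀ W` is simply discarded): the proposed restatement is a weakening.
[this file; pure logic] -/
theorem survivingForm_of_admissibleEternalBound (hS : AdmissibleEternalBound) :
    ∀ R : ℝ, 1 ≤ R → ∃ εs : ℝ, 0 < εs ∧ ∀ ε₀ : ℝ, 0 < ε₀ → ε₀ ≤ εs →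
      ∀ α : Fin 4 → Fin 4 → Fin 4 → ℤ × ℤ × ℤ → ℝ, InTableClass R α →
        ∀ (νh : ℝ) (W : ℤ → ℝ → Em 4), IsEternalVisc ε₀ νh α W →
          EternalSurvivingFwd 1 ε₀ W → UniformBound W := by
  intro R hR
  obtain ⟨εs, hεs, H⟩ := hS R hR
  exact ⟨εs, hεs, fun ε₀ hε₀ hle α hα νh W hW _ => H ε₀ hε₀ hle α hα νh W hW⟩

/-- **The restated glue: (A′) → `EternalRigidityViscOne` → `EternalRigidityViscBddOne`.**  Fix
`R ≥ 1`; (A′) gives a threshold `ε₁` below which every SURVIVING admissible viscous eternal solution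
of an `E₂(R)` table is uniformly bounded; child (B) (`EternalRigidityViscOne`, item 23198) gives a
threshold `ε₂` below which robust blow-up yields an admissible viscous eternal solution surviving
forward at `a = 1`.  Below `min ε₁ ε₂` the extracted solution is admissible and surviving, hence
bounded by (A′) — which is `EternalRigidityViscBdd R 1`.  (Same proof as the landed glue
`wakeRatchet_eternalRigidityViscBddOneOfActionSplit_proof`, with the survival hypothesis now fed to
child (A).)
[this file; pure logic] -/
theorem eternalRigidityViscBddOne_of_survivingForm
    (hA : ∀ R : ℝ, 1 ≤ R → ∃ εs : ℝ, 0 < εs ∧ ∀ ε₀ : ℝ, 0 < ε₀ → ε₀ ≤ εs →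
      ∀ α : Fin 4 → Fin 4 → Fin 4 → ℤ × ℤ × ℤ → ℝ, InTableClass R α →
        ∀ (νh : ℝ) (W : ℤ → ℝ → Em 4), IsEternalVisc ε₀ νh α W →
          EternalSurvivingFwd 1 ε₀ W → UniformBound W)
    (hB : EternalRigidityViscOne) : EternalRigidityViscBddOne := by
  intro R hR
  obtain ⟨ε₁, hε₁, h₁⟩ := hA R hR
  obtain ⟨ε₂, hε₂, h₂⟩ := hB R hR
  refine ⟨min ε₁ ε₂, lt_min hε₁ hε₂, fun ε₀ hε₀ hle α X₀ hα hng => ?_⟩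
  obtain ⟨νh, W, hW, hsurv⟩ := h₂ ε₀ hε₀ (hle.trans (min_le_right _ _)) α X₀ hα hng
  exact ⟨νh, W, hW, h₁ ε₀ hε₀ (hle.trans (min_le_left _ _)) α hα νh W hW hsurv, hsurv⟩

/-- **K1ᵛ(1) makes (A′) vacuous.**  If below some threshold no `E₂(R)` table carries an admissible
viscous eternal solution surviving forward at `a = 1` (the viscous Liouville predicate
`NoSurvivingEternalVisc R 1`, for every `R ≥ 1`), then (A′) holds trivially: its survival hypothesis
is never met.  So (A′) carries content exactly where K1ᵛ(1) fails.
[this file; pure logic] -/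
theorem survivingForm_of_noSurvivingEternalVisc
    (hK : ∀ R : ℝ, 1 ≤ R → NoSurvivingEternalVisc R 1) :
    ∀ R : ℝ, 1 ≤ R → ∃ εs : ℝ, 0 < εs ∧ ∀ ε₀ : ℝ, 0 < ε₀ → ε₀ ≤ εs →
      ∀ α : Fin 4 → Fin 4 → Fin 4 → ℤ × ℤ × ℤ → ℝ, InTableClass R α →
        ∀ (νh : ℝ) (W : ℤ → ℝ → Em 4), IsEternalVisc ε₀ νh α W →
          EternalSurvivingFwd 1 ε₀ W → UniformBound W := by
  intro R hR
  obtain ⟨εs, hεs, H⟩ := hK R hR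
  exact ⟨εs, hεs, fun ε₀ hε₀ hle α hα νh W hW hsurv =>
    (H ε₀ hε₀ hle α hα νh W hW hsurv).elim⟩

/-- **(A′) together with child (B) is exactly what the route's deciding chain consumes.**  With (A′)
and `EternalRigidityViscOne` the hypothesis `h₄ : EternalRigidityViscBddOne` of `WakeRatchet.closes`
is discharged; the remaining hypotheses (`TailRateRatchet`, `TailEnvelopeFinite`, `RatchetStarvation`)
are untouched.  Recorded as the implication into the parent predicate at every spread.
[this file; pure logic] -/
theorem eternalRigidityViscBdd_one_of_survivingForm {R : ℝ} (hR : 1 ≤ R)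
    (hA : ∀ R : ℝ, 1 ≤ R → ∃ εs : ℝ, 0 < εs ∧ ∀ ε₀ : ℝ, 0 < ε₀ → ε₀ ≤ εs →
      ∀ α : Fin 4 → Fin 4 → Fin 4 → ℤ × ℤ × ℤ → ℝ, InTableClass R α →
        ∀ (νh : ℝ) (W : ℤ → ℝ → Em 4), IsEternalVisc ε₀ νh α W →
          EternalSurvivingFwd 1 ε₀ W → UniformBound W)
    (hB : EternalRigidityViscOne) : EternalRigidityViscBdd R 1 :=
  eternalRigidityViscBddOne_of_survivingForm hA hB R hR

end WakeRatchetSurvivingForm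

end Summit.NavierStokesRegularity.NavierStokesRegularity.Theorems

end
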